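import Literature.MathematicalPhysics.QuantumFieldTheory.Balaban1983to89.B9CubeLettersInvReadings
import Literature.MathematicalPhysics.QuantumFieldTheory.Balaban1983to89.B9GaugeReduction335Whole

/-!
# `Balaban1983to89.B9CubeLettersGaugeTransport` — T. Bałaban, *Propagators for lattice gauge theories in a background field*, Commun. Math. Phys.
# **99** (1985) 389–434 [Balaban1985BackgroundPropagators], p. 398 «All these inequalities are invariant with respect to gauge transformations of U»
# and p. 408 «all the results of these theorems are gauge invariant, so they hold for the configuration U also» — PROVED, with EQUAL constants,
# for the readings of covariant letters over the invariant test class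

statement-level skeleton of published theorems with citation tags; proofs where landed; nothing here is a claim about the Yang–Mills mass gap

PDF held: `paper:balaban1985-cmp99-background-propagators` (journal page = PDF page + 388); pp. 395–398, 408 read from the held text layer.
THE PRINT.  p. 396 (3.33)–(3.34): *«G′(U^u) = R(u)G′(U)R(u⁻¹), R(U^u) = R(u)R(U)R(u⁻¹) … G(U^u) = R(u)G(U)R(u⁻¹).»*  p. 398 after (3.47): *«All these
inequalities are invariant with respect to gauge transformations of U.»*  p. 408 (proof of Cor. 3.6): *«… after the gauge transformation u, satisfy
Theorems 3.1–3.3, but all the results of these theorems are gauge invariant, so they hold for the configuration U also.»*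

WHY THIS FILE (cell context: G-B9-LETTERS, module M5.2).  The cell's abstract transfer `B9GaugeReduction335Whole.thms31to33IneqAt_of_invariant` moves
the block `B9.Thms31to33IneqAt` (Theorems 3.1–3.3 at one configuration, ANY constants) from `V` to `U` along EXACT reading invariance
(`KernelReadingsInvariant`, `|C(U)(y, y′)| = |C(V)(y, y′)|`).  This file DISCHARGES those hypotheses at def-Y's carriers: for a COVARIANT site-sector
letter (`Node00.IsCovSiteOpY`, e.g. `G′(U)` by `GpY_isCovSiteOpY`), a covariant bond-sector letter (`Node00.IsCovBondOpY`, e.g. `G(U)` by `GAY_cov`),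
a covariant block letter (e.g. `C(U) = (Q′G′²Q′*)⁻¹(U)` by `CY_cov`), lawful Hölder transporters (`IsGaugeLawS ∕ B`; def-Y's taxicab ones by
`parSY_isGaugeLawS ∕ parBY_isGaugeLawB`) and a gauge function `u` that is a bi-contraction at every point (`IsBiContr`, «u(x) ∈ G ⊂ U(N)»), the
readings over the invariant class (`kernelFamilySInv ∕ kernelFamilyBInv`) at `U^u` EQUAL those at `U` (outer sups re-indexed by the bijection
`Λ ↦ R(u)Λ` of the test class, `testYConj`; constituents invariant by `B9CubeLettersInvReadings` §2), i.e. `KernelReadingsInvariant … U V (ArgRelabel.refl _)`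
for `cfg U = (cfg V)^u`.  The (3.48) kernel and the block transfer ★★ `thms31to33IneqAt_of_gauge` (SAME constants — the p. 408 sentence for def-Y's
letters) follow in `B9Cor36GaugeReductionCube` §0, together with Cor. 3.6 on one cube.

WHAT IS PROVED (all `theorem`s, no `sorry`).  §1 at a configuration of the member's lattice: `eLatS_conj`, `hLatS_conj`, `e4S ∕ h2S ∕ l2S ∕ globS_conj`
(site sector), `eB ∕ h1B ∕ e4B ∕ h2B ∕ l2B ∕ globB_conj` (bond sector); §2 over a backgrounds record `B` read through `cfg`: ★ `kernelReadingsInvariant_SInv`,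
★ `kernelReadingsInvariant_BInv`.
-/

noncomputable section

namespace Literature.MathematicalPhysics.QuantumFieldTheory.Balaban1983to89.B9CubeLettersGaugeTransport

open Node00 B9CubeLettersInvReadings
open B9GaugeReduction335Whole (ArgRelabel KernelReadingsInvariant)
open B9Eq39Adjoint (R R_smul)
open B6KLevelCensusIndexV1 (KIdx)
open B6Ineq2142KLevelV1 (β)
open B6Prop22KLevelCensusEta (epow)
open scoped Matrix

variable {d ℓ : ℕ} {hd : 1 ≤ d + 1} {hL : Odd (ℓ + 1) ∧ 1 < ℓ + 1} {b₀ b₁ : ℝ}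
variable {𝔸 : Type} [NormedRing 𝔸] [NormedAlgebra ℂ 𝔸] [CompleteSpace 𝔸]

/-! ## §1 On the member's lattice: every reading of a covariant letter at `U^u` on `R(u)Λ` is the reading at `U` on `Λ` -/

section Lattice

variable (i : KIdx d ℓ hd hL b₀ b₁) {g : GaugeY 𝔸 i} (V : CfgY 𝔸 i)

section Site

variable {O : SiteOpY 𝔸 i} {par : SiteParY 𝔸 i}

/-- covariance, applied: `O(U^u)R(u)Φ = R(u)O(U)Φ`. [cite: Balaban1985BackgroundPropagators, (3.33) p.396] -/
theorem cov_apply (hO : IsCovSiteOpY i O) (Φ : SiteY i → 𝔸) :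
    O (gaugeY i g V) (conjY (gSiteY i g) Φ) = conjY (gSiteY i g) (O V Φ) :=
  (hO g V).apply Φ

/-- **(3.42) entries**: `eLatS` at `(U^u, R(u)Λ)` = `eLatS` at `(U, Λ)`. [cite: Balaban1985BackgroundPropagators, (3.42) p.397 + p.398 (gauge invariance), (3.31)∕(3.33) pp.395–396] -/
theorem eLatS_conj (hO : IsCovSiteOpY i O) (hg : IsBiContr g) (Λ : SiteY i → 𝔸) (s : BlkY i) :
    eLatS i O (gaugeY i g V) (conjY (gSiteY i g) Λ) s = eLatS i O V Λ s := by
  simp only [eLatS, cov_apply i V hO, cdS_conj, cdsS_conj, lapS_conj, supBlkS_conjY i (hg.site i), supBlkS'_conjY i (hg.site i)]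

/-- **(3.43) entries**: `hLatS` at `(U^u, R(u)Λ)` = `hLatS` at `(U, Λ)` (lawful transporter). [cite: Balaban1985BackgroundPropagators, (3.43) p.398 + p.398 (gauge invariance), (3.32)∕(3.33) pp.395–396] -/
theorem hLatS_conj (hO : IsCovSiteOpY i O) (hpar : IsGaugeLawS i par) (hg : IsBiContr g) (Λ : SiteY i → 𝔸) (α : ℝ) (ζ : SiteY i → ℝ) :
    hLatS i O par (gaugeY i g V) (conjY (gSiteY i g) Λ) α ζ = hLatS i O par V Λ α ζ := by
  simp only [hLatS, cov_apply i V hO, cdS_conj, cdsS_conj, hqS_smul_conjY i hpar hg]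

/-- **(3.44) entry**. [cite: Balaban1985BackgroundPropagators, (3.44) p.398 + p.398 (gauge invariance)] -/
theorem e4S_conj (hO : IsCovSiteOpY i O) (hg : IsBiContr g) (Λ : SiteY i → 𝔸) (s : BlkY i) :
    (⨆ μ : Fin (d + 1), supBlkS' i s (fun ν => cdS i (gaugeY i g V) μ (O (gaugeY i g V) (cdsS i (gaugeY i g V) ν (conjY (gSiteY i g) Λ))))) =
      ⨆ μ : Fin (d + 1), supBlkS' i s (fun ν => cdS i V μ (O V (cdsS i V ν Λ))) := by
  simp only [cov_apply i V hO, cdS_conj, cdsS_conj, supBlkS'_conjY i (hg.site i)]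

/-- **(3.45) entry**. [cite: Balaban1985BackgroundPropagators, (3.45) p.398 + p.398 (gauge invariance)] -/
theorem h2S_conj (hO : IsCovSiteOpY i O) (hpar : IsGaugeLawS i par) (hg : IsBiContr g) (Λ : SiteY i → 𝔸) (α : ℝ) (z : SiteY i → ℝ) :
    (⨆ μ : Fin (d + 1), ⨆ ν : Fin (d + 1), hqS i (par (gaugeY i g V)) α
        (fun w => ((z w : ℝ) : ℂ) • cdS i (gaugeY i g V) μ (O (gaugeY i g V) (cdsS i (gaugeY i g V) ν (conjY (gSiteY i g) Λ))) w)) =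
      ⨆ μ : Fin (d + 1), ⨆ ν : Fin (d + 1), hqS i (par V) α (fun w => ((z w : ℝ) : ℂ) • cdS i V μ (O V (cdsS i V ν Λ)) w) := by
  simp only [cov_apply i V hO, cdS_conj, cdsS_conj, hqS_smul_conjY i hpar hg]

/-- **(3.46) entries**. [cite: Balaban1985BackgroundPropagators, (3.46) p.398 + p.398 (gauge invariance)] -/
theorem l2S_conj (hO : IsCovSiteOpY i O) (hg : IsBiContr g) (Λ : SiteY i → 𝔸) (hh : SiteY i → ℝ) :
    (![l2OfY hh (O (gaugeY i g V) (conjY (gSiteY i g) Λ)),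
        ⨆ μ : Fin (d + 1), l2OfY hh (cdS i (gaugeY i g V) μ (O (gaugeY i g V) (conjY (gSiteY i g) Λ))),
        ⨆ μ : Fin (d + 1), l2OfY hh (O (gaugeY i g V) (cdsS i (gaugeY i g V) μ (conjY (gSiteY i g) Λ))),
        ⨆ μ : Fin (d + 1), ⨆ ν : Fin (d + 1), l2OfY hh (cdS i (gaugeY i g V) μ (O (gaugeY i g V) (cdsS i (gaugeY i g V) ν (conjY (gSiteY i g) Λ)))),
        ⨆ μ : Fin (d + 1), ⨆ ν : Fin (d + 1), l2OfY hh (cdS i (gaugeY i g V) μ (cdS i (gaugeY i g V) ν (O (gaugeY i g V) (conjY (gSiteY i g) Λ)))),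
        ⨆ μ : Fin (d + 1), ⨆ ν : Fin (d + 1), l2OfY hh (O (gaugeY i g V) (cdsS i (gaugeY i g V) μ (cdsS i (gaugeY i g V) ν (conjY (gSiteY i g) Λ))))]
        : Fin 6 → ℝ) =
      ![l2OfY hh (O V Λ),
        ⨆ μ : Fin (d + 1), l2OfY hh (cdS i V μ (O V Λ)),
        ⨆ μ : Fin (d + 1), l2OfY hh (O V (cdsS i V μ Λ)),
        ⨆ μ : Fin (d + 1), ⨆ ν : Fin (d + 1), l2OfY hh (cdS i V μ (O V (cdsS i V ν Λ))),
        ⨆ μ : Fin (d + 1), ⨆ ν : Fin (d + 1), l2OfY hh (cdS i V μ (cdS i V ν (O V Λ))),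
        ⨆ μ : Fin (d + 1), ⨆ ν : Fin (d + 1), l2OfY hh (O V (cdsS i V μ (cdsS i V ν Λ)))] := by
  simp only [cov_apply i V hO, cdS_conj, cdsS_conj, l2OfY_conjY (hg.site i)]

/-- **(3.47) entries**. [cite: Balaban1985BackgroundPropagators, (3.47) p.398 + p.398 (gauge invariance)] -/
theorem globS_conj (hO : IsCovSiteOpY i O) (hg : IsBiContr g) (Λ : SiteY i → 𝔸) (γ : ℝ) :
    (![wNormSY i (2 + γ) (fun z => ((etaS i ^ 2 : ℝ) : ℂ) • O (gaugeY i g V) (conjY (gSiteY i g) Λ) z),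
        ⨆ μ : Fin (d + 1), wNormSY i (1 + γ) (fun z => ((etaS i : ℝ) : ℂ) • cdS i (gaugeY i g V) μ (O (gaugeY i g V) (conjY (gSiteY i g) Λ)) z),
        ⨆ μ : Fin (d + 1), wNormSY i (1 + γ) (fun z => ((etaS i : ℝ) : ℂ) • O (gaugeY i g V) (cdsS i (gaugeY i g V) μ (conjY (gSiteY i g) Λ)) z),
        wNormSY i γ (lapS i (gaugeY i g V) (O (gaugeY i g V) (conjY (gSiteY i g) Λ)))] : Fin 4 → ℝ) =
      ![wNormSY i (2 + γ) (fun z => ((etaS i ^ 2 : ℝ) : ℂ) • O V Λ z),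
        ⨆ μ : Fin (d + 1), wNormSY i (1 + γ) (fun z => ((etaS i : ℝ) : ℂ) • cdS i V μ (O V Λ) z),
        ⨆ μ : Fin (d + 1), wNormSY i (1 + γ) (fun z => ((etaS i : ℝ) : ℂ) • O V (cdsS i V μ Λ) z),
        wNormSY i γ (lapS i V (O V Λ))] := by
  simp only [cov_apply i V hO, cdS_conj, cdsS_conj, lapS_conj, wNormSY_smul_conjY i (hg.site i), wNormSY_conjY i (hg.site i)]

end Site

section Bond

variable {O : BondOpY 𝔸 i} {par : BondParY 𝔸 i}

/-- covariance, applied (bond sector): `O(U^u)R(u)A = R(u)O(U)A`. [cite: Balaban1985BackgroundPropagators, (3.34) p.396] -/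
theorem covB_apply (hO : IsCovBondOpY i O) (A : FBondY i → 𝔸) :
    O (gaugeY i g V) (conjY (gBondY i g) A) = conjY (gBondY i g) (O V A) :=
  (hO g V).apply A

/-- **(3.42) entries, bond sector**. [cite: Balaban1985BackgroundPropagators, Thm 3.3 p.399, (3.42) p.397 + p.398 (gauge invariance)] -/
theorem eB_conj (hO : IsCovBondOpY i O) (hg : IsBiContr g) (Λ : FBondY i → 𝔸) (s : BlkY i) :
    (![supInB i s (O (gaugeY i g V) (conjY (gBondY i g) Λ)),
        ⨆ ν : Fin (d + 1), supInB i s (cdB i (gaugeY i g V) ν (O (gaugeY i g V) (conjY (gBondY i g) Λ))),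
        ⨆ ν : Fin (d + 1), supInB i s (O (gaugeY i g V) (cdsB i (gaugeY i g V) ν (conjY (gBondY i g) Λ))),
        supInB i s (lapB i (gaugeY i g V) (O (gaugeY i g V) (conjY (gBondY i g) Λ)))] : Fin 4 → ℝ) =
      ![supInB i s (O V Λ), ⨆ ν : Fin (d + 1), supInB i s (cdB i V ν (O V Λ)), ⨆ ν : Fin (d + 1), supInB i s (O V (cdsB i V ν Λ)),
        supInB i s (lapB i V (O V Λ))] := by
  simp only [covB_apply i V hO, cdB_conj, cdsB_conj, lapB_conj, supInB_conjY i (hg.bond i)]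

/-- **(3.43) entries, bond sector** (lawful transporter). [cite: Balaban1985BackgroundPropagators, Thm 3.3 p.399, (3.43) p.398 + p.398 (gauge invariance)] -/
theorem h1B_conj (hO : IsCovBondOpY i O) (hpar : IsGaugeLawB i par) (hg : IsBiContr g) (Λ : FBondY i → 𝔸) (α : ℝ) (z : FBondY i → ℝ) :
    max (⨆ ν : Fin (d + 1), holderQB i (par (gaugeY i g V)) α z (cdB i (gaugeY i g V) ν (O (gaugeY i g V) (conjY (gBondY i g) Λ))))
        (⨆ ν : Fin (d + 1), holderQB i (par (gaugeY i g V)) α z (O (gaugeY i g V) (cdsB i (gaugeY i g V) ν (conjY (gBondY i g) Λ)))) =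
      max (⨆ ν : Fin (d + 1), holderQB i (par V) α z (cdB i V ν (O V Λ))) (⨆ ν : Fin (d + 1), holderQB i (par V) α z (O V (cdsB i V ν Λ))) := by
  simp only [covB_apply i V hO, cdB_conj, cdsB_conj, holderQB_conjY i hpar hg]

/-- **(3.44) entry, bond sector**. [cite: Balaban1985BackgroundPropagators, Thm 3.3 p.399, (3.44) p.398 + p.398 (gauge invariance)] -/
theorem e4B_conj (hO : IsCovBondOpY i O) (hg : IsBiContr g) (Λ : FBondY i → 𝔸) (s : BlkY i) :
    (⨆ ν : Fin (d + 1), ⨆ μ : Fin (d + 1), supInB i s (cdB i (gaugeY i g V) ν (O (gaugeY i g V) (cdsB i (gaugeY i g V) μ (conjY (gBondY i g) Λ))))) =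
      ⨆ ν : Fin (d + 1), ⨆ μ : Fin (d + 1), supInB i s (cdB i V ν (O V (cdsB i V μ Λ))) := by
  simp only [covB_apply i V hO, cdB_conj, cdsB_conj, supInB_conjY i (hg.bond i)]

/-- **(3.45) entry, bond sector**. [cite: Balaban1985BackgroundPropagators, Thm 3.3 p.399, (3.45) p.398 + p.398 (gauge invariance)] -/
theorem h2B_conj (hO : IsCovBondOpY i O) (hpar : IsGaugeLawB i par) (hg : IsBiContr g) (Λ : FBondY i → 𝔸) (α : ℝ) (z : FBondY i → ℝ) :
    (⨆ ν : Fin (d + 1), ⨆ μ : Fin (d + 1), holderQB i (par (gaugeY i g V)) α z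
        (cdB i (gaugeY i g V) ν (O (gaugeY i g V) (cdsB i (gaugeY i g V) μ (conjY (gBondY i g) Λ))))) =
      ⨆ ν : Fin (d + 1), ⨆ μ : Fin (d + 1), holderQB i (par V) α z (cdB i V ν (O V (cdsB i V μ Λ))) := by
  simp only [covB_apply i V hO, cdB_conj, cdsB_conj, holderQB_conjY i hpar hg]

/-- **(3.46) entries, bond sector**. [cite: Balaban1985BackgroundPropagators, Thm 3.3 p.399, (3.46) p.398 + p.398 (gauge invariance)] -/
theorem l2B_conj (hO : IsCovBondOpY i O) (hg : IsBiContr g) (Λ : FBondY i → 𝔸) (hh : FBondY i → ℝ) :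
    (![l2OfY hh (O (gaugeY i g V) (conjY (gBondY i g) Λ)),
        ⨆ ν : Fin (d + 1), l2OfY hh (cdB i (gaugeY i g V) ν (O (gaugeY i g V) (conjY (gBondY i g) Λ))),
        ⨆ ν : Fin (d + 1), l2OfY hh (O (gaugeY i g V) (cdsB i (gaugeY i g V) ν (conjY (gBondY i g) Λ))),
        ⨆ ν : Fin (d + 1), ⨆ μ : Fin (d + 1), l2OfY hh (cdB i (gaugeY i g V) ν (O (gaugeY i g V) (cdsB i (gaugeY i g V) μ (conjY (gBondY i g) Λ)))),
        ⨆ ν : Fin (d + 1), ⨆ μ : Fin (d + 1), l2OfY hh (cdB i (gaugeY i g V) ν (cdB i (gaugeY i g V) μ (O (gaugeY i g V) (conjY (gBondY i g) Λ)))),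
        ⨆ ν : Fin (d + 1), ⨆ μ : Fin (d + 1), l2OfY hh (O (gaugeY i g V) (cdsB i (gaugeY i g V) ν (cdsB i (gaugeY i g V) μ (conjY (gBondY i g) Λ))))]
        : Fin 6 → ℝ) =
      ![l2OfY hh (O V Λ),
        ⨆ ν : Fin (d + 1), l2OfY hh (cdB i V ν (O V Λ)),
        ⨆ ν : Fin (d + 1), l2OfY hh (O V (cdsB i V ν Λ)),
        ⨆ ν : Fin (d + 1), ⨆ μ : Fin (d + 1), l2OfY hh (cdB i V ν (O V (cdsB i V μ Λ))),
        ⨆ ν : Fin (d + 1), ⨆ μ : Fin (d + 1), l2OfY hh (cdB i V ν (cdB i V μ (O V Λ))),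
        ⨆ ν : Fin (d + 1), ⨆ μ : Fin (d + 1), l2OfY hh (O V (cdsB i V ν (cdsB i V μ Λ)))] := by
  simp only [covB_apply i V hO, cdB_conj, cdsB_conj, l2OfY_conjY (hg.bond i)]

/-- **(3.47) entries, bond sector**. [cite: Balaban1985BackgroundPropagators, Thm 3.3 p.399, (3.47) p.398 + p.398 (gauge invariance)] -/
theorem globB_conj (hO : IsCovBondOpY i O) (hg : IsBiContr g) (Λ : FBondY i → 𝔸) (γ : ℝ) :
    (![wNormBY i (2 + γ) (O (gaugeY i g V) (conjY (gBondY i g) Λ)),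
        ⨆ ν : Fin (d + 1), wNormBY i (1 + γ) (cdB i (gaugeY i g V) ν (O (gaugeY i g V) (conjY (gBondY i g) Λ))),
        ⨆ ν : Fin (d + 1), wNormBY i (1 + γ) (O (gaugeY i g V) (cdsB i (gaugeY i g V) ν (conjY (gBondY i g) Λ))),
        wNormBY i γ (lapB i (gaugeY i g V) (O (gaugeY i g V) (conjY (gBondY i g) Λ)))] : Fin 4 → ℝ) =
      ![wNormBY i (2 + γ) (O V Λ), ⨆ ν : Fin (d + 1), wNormBY i (1 + γ) (cdB i V ν (O V Λ)),
        ⨆ ν : Fin (d + 1), wNormBY i (1 + γ) (O V (cdsB i V ν Λ)), wNormBY i γ (lapB i V (O V Λ))] := by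
  simp only [covB_apply i V hO, cdB_conj, cdsB_conj, lapB_conj, wNormBY_conjY i (hg.bond i)]

end Bond

end Lattice

/-! ## §2 Over a backgrounds record: the readings are `KernelReadingsInvariant` along the identity relabel -/

section Record

variable (i : KIdx d ℓ hd hL b₀ b₁) {B : B9.Backgrounds} (cfg : B.Cfg → CfgY 𝔸 i) {g : GaugeY 𝔸 i} {U V : B.Cfg}

/-- ★ **THE READINGS OF A COVARIANT SITE-SECTOR LETTER OVER THE INVARIANT CLASS ARE GAUGE INVARIANT, EXACTLY**: for `cfg U = (cfg V)^u` with `u`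
a bi-contraction, covariant `O` and a lawful transporter, `KernelReadingsInvariant (kernelFamilySInv i B cfg O par) U V (ArgRelabel.refl _)`.
[cite: Balaban1985BackgroundPropagators, (3.42)–(3.47) pp.397–398 + p.398 («All these inequalities are invariant with respect to gauge transformations of U»), (3.33) p.396] -/
theorem kernelReadingsInvariant_SInv {O : SiteOpY 𝔸 i} (hO : IsCovSiteOpY i O) {par : SiteParY 𝔸 i} (hpar : IsGaugeLawS i par)
    (hg : IsBiContr g) (hUV : cfg U = gaugeY i g (cfg V)) :
    KernelReadingsInvariant (kernelFamilySInv i B cfg O par) U V (ArgRelabel.refl _) where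
  e n lam y := by
    cases lam with
    | inr _ => rfl
    | inl f =>
      show etaS i ^ (epow n) * (⨆ Λ : TestY 𝔸 f, eLatS i O (cfg U) Λ.1 (β i.hN i.D i.hk y) n) =
        etaS i ^ (epow n) * ⨆ Λ : TestY 𝔸 f, eLatS i O (cfg V) Λ.1 (β i.hN i.D i.hk y) n
      rw [hUV]
      exact congrArg _ (Equiv.iSup_congr (testYConj (hg.site i) f) fun Λ => by
        rw [testYConj_coe, eLatS_conj i (cfg V) hO hg]).symm
  h1 lam α ζ := by
    cases lam with
    | inr _ => rfl
    | inl f =>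
      cases ζ with
      | inr _ => rfl
      | inl z =>
        show (⨆ Λ : TestY 𝔸 f, hLatS i O par (cfg U) Λ.1 α z) = ⨆ Λ : TestY 𝔸 f, hLatS i O par (cfg V) Λ.1 α z
        rw [hUV]
        exact (Equiv.iSup_congr (testYConj (hg.site i) f) fun Λ => by rw [testYConj_coe, hLatS_conj i (cfg V) hO hpar hg]).symm
  e4 lam y := by
    cases lam with
    | inr _ => rfl
    | inl f =>
      show (⨆ Λ : TestY 𝔸 f, ⨆ μ : Fin (d + 1), supBlkS' i (β i.hN i.D i.hk y)
          (fun ν => cdS i (cfg U) μ (O (cfg U) (cdsS i (cfg U) ν Λ.1)))) =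
        ⨆ Λ : TestY 𝔸 f, ⨆ μ : Fin (d + 1), supBlkS' i (β i.hN i.D i.hk y) (fun ν => cdS i (cfg V) μ (O (cfg V) (cdsS i (cfg V) ν Λ.1)))
      rw [hUV]
      exact (Equiv.iSup_congr (testYConj (hg.site i) f) fun Λ => by rw [testYConj_coe, e4S_conj i (cfg V) hO hg]).symm
  h2 lam α ζ := by
    cases lam with
    | inr _ => rfl
    | inl f =>
      cases ζ with
      | inr _ => rfl
      | inl z =>
        show (⨆ Λ : TestY 𝔸 f, ⨆ μ : Fin (d + 1), ⨆ ν : Fin (d + 1), hqS i (par (cfg U)) α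
            (fun w => ((z w : ℝ) : ℂ) • cdS i (cfg U) μ (O (cfg U) (cdsS i (cfg U) ν Λ.1)) w)) =
          ⨆ Λ : TestY 𝔸 f, ⨆ μ : Fin (d + 1), ⨆ ν : Fin (d + 1), hqS i (par (cfg V)) α
            (fun w => ((z w : ℝ) : ℂ) • cdS i (cfg V) μ (O (cfg V) (cdsS i (cfg V) ν Λ.1)) w)
        rw [hUV]
        exact (Equiv.iSup_congr (testYConj (hg.site i) f) fun Λ => by rw [testYConj_coe, h2S_conj i (cfg V) hO hpar hg]).symm
  l2 n lam h := by
    cases lam with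
    | inr _ => rfl
    | inl f =>
      cases h with
      | inr _ => rfl
      | inl hh =>
        show etaS i ^ ((![2, 1, 1, 0, 0, 0] : Fin 6 → ℕ) n) * (⨆ Λ : TestY 𝔸 f,
            ((![l2OfY hh (O (cfg U) Λ.1),
                ⨆ μ : Fin (d + 1), l2OfY hh (cdS i (cfg U) μ (O (cfg U) Λ.1)),
                ⨆ μ : Fin (d + 1), l2OfY hh (O (cfg U) (cdsS i (cfg U) μ Λ.1)),
                ⨆ μ : Fin (d + 1), ⨆ ν : Fin (d + 1), l2OfY hh (cdS i (cfg U) μ (O (cfg U) (cdsS i (cfg U) ν Λ.1))),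
                ⨆ μ : Fin (d + 1), ⨆ ν : Fin (d + 1), l2OfY hh (cdS i (cfg U) μ (cdS i (cfg U) ν (O (cfg U) Λ.1))),
                ⨆ μ : Fin (d + 1), ⨆ ν : Fin (d + 1), l2OfY hh (O (cfg U) (cdsS i (cfg U) μ (cdsS i (cfg U) ν Λ.1)))] : Fin 6 → ℝ) n)) =
          etaS i ^ ((![2, 1, 1, 0, 0, 0] : Fin 6 → ℕ) n) * ⨆ Λ : TestY 𝔸 f,
            ((![l2OfY hh (O (cfg V) Λ.1),
                ⨆ μ : Fin (d + 1), l2OfY hh (cdS i (cfg V) μ (O (cfg V) Λ.1)),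
                ⨆ μ : Fin (d + 1), l2OfY hh (O (cfg V) (cdsS i (cfg V) μ Λ.1)),
                ⨆ μ : Fin (d + 1), ⨆ ν : Fin (d + 1), l2OfY hh (cdS i (cfg V) μ (O (cfg V) (cdsS i (cfg V) ν Λ.1))),
                ⨆ μ : Fin (d + 1), ⨆ ν : Fin (d + 1), l2OfY hh (cdS i (cfg V) μ (cdS i (cfg V) ν (O (cfg V) Λ.1))),
                ⨆ μ : Fin (d + 1), ⨆ ν : Fin (d + 1), l2OfY hh (O (cfg V) (cdsS i (cfg V) μ (cdsS i (cfg V) ν Λ.1)))] : Fin 6 → ℝ) n)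
        rw [hUV]
        exact congrArg _ (Equiv.iSup_congr (testYConj (hg.site i) f) fun Λ => by rw [testYConj_coe, l2S_conj i (cfg V) hO hg]).symm
  glob n lam γ := by
    cases lam with
    | inr _ => rfl
    | inl f =>
      show (⨆ Λ : TestY 𝔸 f,
          ((![wNormSY i (2 + γ) (fun z => ((etaS i ^ 2 : ℝ) : ℂ) • O (cfg U) Λ.1 z),
              ⨆ μ : Fin (d + 1), wNormSY i (1 + γ) (fun z => ((etaS i : ℝ) : ℂ) • cdS i (cfg U) μ (O (cfg U) Λ.1) z),
              ⨆ μ : Fin (d + 1), wNormSY i (1 + γ) (fun z => ((etaS i : ℝ) : ℂ) • O (cfg U) (cdsS i (cfg U) μ Λ.1) z),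
              wNormSY i γ (lapS i (cfg U) (O (cfg U) Λ.1))] : Fin 4 → ℝ) n)) =
        ⨆ Λ : TestY 𝔸 f,
          ((![wNormSY i (2 + γ) (fun z => ((etaS i ^ 2 : ℝ) : ℂ) • O (cfg V) Λ.1 z),
              ⨆ μ : Fin (d + 1), wNormSY i (1 + γ) (fun z => ((etaS i : ℝ) : ℂ) • cdS i (cfg V) μ (O (cfg V) Λ.1) z),
              ⨆ μ : Fin (d + 1), wNormSY i (1 + γ) (fun z => ((etaS i : ℝ) : ℂ) • O (cfg V) (cdsS i (cfg V) μ Λ.1) z),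
              wNormSY i γ (lapS i (cfg V) (O (cfg V) Λ.1))] : Fin 4 → ℝ) n)
      rw [hUV]
      exact (Equiv.iSup_congr (testYConj (hg.site i) f) fun Λ => by rw [testYConj_coe, globS_conj i (cfg V) hO hg]).symm

/-- ★ **THE READINGS OF A COVARIANT BOND-SECTOR LETTER OVER THE INVARIANT CLASS ARE GAUGE INVARIANT, EXACTLY**.
[cite: Balaban1985BackgroundPropagators, Thm 3.3 p.399, (3.42)–(3.47) pp.397–398 + p.398 (gauge invariance), (3.34) p.396] -/
theorem kernelReadingsInvariant_BInv {O : BondOpY 𝔸 i} (hO : IsCovBondOpY i O) {par : BondParY 𝔸 i} (hpar : IsGaugeLawB i par)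
    (hg : IsBiContr g) (hUV : cfg U = gaugeY i g (cfg V)) :
    KernelReadingsInvariant (kernelFamilyBInv i B cfg O par) U V (ArgRelabel.refl _) where
  e n lam y := by
    cases lam with
    | inl _ => rfl
    | inr J =>
      show (⨆ Λ : TestY 𝔸 J,
          ((![supInB i (β i.hN i.D i.hk y) (O (cfg U) Λ.1),
              ⨆ ν : Fin (d + 1), supInB i (β i.hN i.D i.hk y) (cdB i (cfg U) ν (O (cfg U) Λ.1)),
              ⨆ ν : Fin (d + 1), supInB i (β i.hN i.D i.hk y) (O (cfg U) (cdsB i (cfg U) ν Λ.1)),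
              supInB i (β i.hN i.D i.hk y) (lapB i (cfg U) (O (cfg U) Λ.1))] : Fin 4 → ℝ) n)) =
        ⨆ Λ : TestY 𝔸 J,
          ((![supInB i (β i.hN i.D i.hk y) (O (cfg V) Λ.1),
              ⨆ ν : Fin (d + 1), supInB i (β i.hN i.D i.hk y) (cdB i (cfg V) ν (O (cfg V) Λ.1)),
              ⨆ ν : Fin (d + 1), supInB i (β i.hN i.D i.hk y) (O (cfg V) (cdsB i (cfg V) ν Λ.1)),
              supInB i (β i.hN i.D i.hk y) (lapB i (cfg V) (O (cfg V) Λ.1))] : Fin 4 → ℝ) n)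
      rw [hUV]
      exact (Equiv.iSup_congr (testYConj (hg.bond i) J) fun Λ => by rw [testYConj_coe, eB_conj i (cfg V) hO hg]).symm
  h1 lam α ζ := by
    cases lam with
    | inl _ => rfl
    | inr J =>
      cases ζ with
      | inl _ => rfl
      | inr z =>
        show (⨆ Λ : TestY 𝔸 J,
            max (⨆ ν : Fin (d + 1), holderQB i (par (cfg U)) α z (cdB i (cfg U) ν (O (cfg U) Λ.1)))
              (⨆ ν : Fin (d + 1), holderQB i (par (cfg U)) α z (O (cfg U) (cdsB i (cfg U) ν Λ.1)))) =
          ⨆ Λ : TestY 𝔸 J,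
            max (⨆ ν : Fin (d + 1), holderQB i (par (cfg V)) α z (cdB i (cfg V) ν (O (cfg V) Λ.1)))
              (⨆ ν : Fin (d + 1), holderQB i (par (cfg V)) α z (O (cfg V) (cdsB i (cfg V) ν Λ.1)))
        rw [hUV]
        exact (Equiv.iSup_congr (testYConj (hg.bond i) J) fun Λ => by rw [testYConj_coe, h1B_conj i (cfg V) hO hpar hg]).symm
  e4 lam y := by
    cases lam with
    | inl _ => rfl
    | inr J =>
      show (⨆ Λ : TestY 𝔸 J, ⨆ ν : Fin (d + 1), ⨆ μ : Fin (d + 1),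
          supInB i (β i.hN i.D i.hk y) (cdB i (cfg U) ν (O (cfg U) (cdsB i (cfg U) μ Λ.1)))) =
        ⨆ Λ : TestY 𝔸 J, ⨆ ν : Fin (d + 1), ⨆ μ : Fin (d + 1),
          supInB i (β i.hN i.D i.hk y) (cdB i (cfg V) ν (O (cfg V) (cdsB i (cfg V) μ Λ.1)))
      rw [hUV]
      exact (Equiv.iSup_congr (testYConj (hg.bond i) J) fun Λ => by rw [testYConj_coe, e4B_conj i (cfg V) hO hg]).symm
  h2 lam α ζ := by
    cases lam with
    | inl _ => rfl
    | inr J =>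
      cases ζ with
      | inl _ => rfl
      | inr z =>
        show (⨆ Λ : TestY 𝔸 J, ⨆ ν : Fin (d + 1), ⨆ μ : Fin (d + 1),
            holderQB i (par (cfg U)) α z (cdB i (cfg U) ν (O (cfg U) (cdsB i (cfg U) μ Λ.1)))) =
          ⨆ Λ : TestY 𝔸 J, ⨆ ν : Fin (d + 1), ⨆ μ : Fin (d + 1),
            holderQB i (par (cfg V)) α z (cdB i (cfg V) ν (O (cfg V) (cdsB i (cfg V) μ Λ.1)))
        rw [hUV]
        exact (Equiv.iSup_congr (testYConj (hg.bond i) J) fun Λ => by rw [testYConj_coe, h2B_conj i (cfg V) hO hpar hg]).symm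
  l2 n lam h := by
    cases lam with
    | inl _ => rfl
    | inr J =>
      cases h with
      | inl _ => rfl
      | inr hh =>
        show (⨆ Λ : TestY 𝔸 J,
            ((![l2OfY hh (O (cfg U) Λ.1),
                ⨆ ν : Fin (d + 1), l2OfY hh (cdB i (cfg U) ν (O (cfg U) Λ.1)),
                ⨆ ν : Fin (d + 1), l2OfY hh (O (cfg U) (cdsB i (cfg U) ν Λ.1)),
                ⨆ ν : Fin (d + 1), ⨆ μ : Fin (d + 1), l2OfY hh (cdB i (cfg U) ν (O (cfg U) (cdsB i (cfg U) μ Λ.1))),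
                ⨆ ν : Fin (d + 1), ⨆ μ : Fin (d + 1), l2OfY hh (cdB i (cfg U) ν (cdB i (cfg U) μ (O (cfg U) Λ.1))),
                ⨆ ν : Fin (d + 1), ⨆ μ : Fin (d + 1), l2OfY hh (O (cfg U) (cdsB i (cfg U) ν (cdsB i (cfg U) μ Λ.1)))] : Fin 6 → ℝ) n)) =
          ⨆ Λ : TestY 𝔸 J,
            ((![l2OfY hh (O (cfg V) Λ.1),
                ⨆ ν : Fin (d + 1), l2OfY hh (cdB i (cfg V) ν (O (cfg V) Λ.1)),
                ⨆ ν : Fin (d + 1), l2OfY hh (O (cfg V) (cdsB i (cfg V) ν Λ.1)),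
                ⨆ ν : Fin (d + 1), ⨆ μ : Fin (d + 1), l2OfY hh (cdB i (cfg V) ν (O (cfg V) (cdsB i (cfg V) μ Λ.1))),
                ⨆ ν : Fin (d + 1), ⨆ μ : Fin (d + 1), l2OfY hh (cdB i (cfg V) ν (cdB i (cfg V) μ (O (cfg V) Λ.1))),
                ⨆ ν : Fin (d + 1), ⨆ μ : Fin (d + 1), l2OfY hh (O (cfg V) (cdsB i (cfg V) ν (cdsB i (cfg V) μ Λ.1)))] : Fin 6 → ℝ) n)
        rw [hUV]
        exact (Equiv.iSup_congr (testYConj (hg.bond i) J) fun Λ => by rw [testYConj_coe, l2B_conj i (cfg V) hO hg]).symm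
  glob n lam γ := by
    cases lam with
    | inl _ => rfl
    | inr J =>
      show (⨆ Λ : TestY 𝔸 J,
          ((![wNormBY i (2 + γ) (O (cfg U) Λ.1),
              ⨆ ν : Fin (d + 1), wNormBY i (1 + γ) (cdB i (cfg U) ν (O (cfg U) Λ.1)),
              ⨆ ν : Fin (d + 1), wNormBY i (1 + γ) (O (cfg U) (cdsB i (cfg U) ν Λ.1)),
              wNormBY i γ (lapB i (cfg U) (O (cfg U) Λ.1))] : Fin 4 → ℝ) n)) =
        ⨆ Λ : TestY 𝔸 J,
          ((![wNormBY i (2 + γ) (O (cfg V) Λ.1),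
              ⨆ ν : Fin (d + 1), wNormBY i (1 + γ) (cdB i (cfg V) ν (O (cfg V) Λ.1)),
              ⨆ ν : Fin (d + 1), wNormBY i (1 + γ) (O (cfg V) (cdsB i (cfg V) ν Λ.1)),
              wNormBY i γ (lapB i (cfg V) (O (cfg V) Λ.1))] : Fin 4 → ℝ) n)
      rw [hUV]
      exact (Equiv.iSup_congr (testYConj (hg.bond i) J) fun Λ => by rw [testYConj_coe, globB_conj i (cfg V) hO hg]).symm

end Record

end Literature.MathematicalPhysics.QuantumFieldTheory.Balaban1983to89.B9CubeLettersGaugeTransport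

end
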